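import Summits.CriticalPhenomena.PercolationContinuityZ3.Theorems.SahiAEOrthantShift
import Mathlib.MeasureTheory.Function.Floor

/-!
# The structure theorem in every dimension: a Borel everywhere-supermodular version of an a.e.-supermodular function

Support file of the Sahi cell (`prim-sahi`, typer seat, generation 23; `--supports stmt-CriticalPhenomena-4575`).
Theorems only (no definitions, no named facts, no sorries).

**Theorem** (`exists_measurable_supermodular_version_of_ae_unbounded`).  Let `ι` be finite and let
`φ : ℝ^ι → ℝ` be measurable and supermodular on Lebesgue-almost every pair,
`φ(x) + φ(y) ≤ φ(x ∧ y) + φ(x ∨ y)` for `λ ⊗ λ`-a.e. `(x, y)`.  Then there is a Borel `ψ = φ` almost everywhere with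
`ψ(x) + ψ(y) ≤ ψ(x ∧ y) + ψ(x ∨ y)` for ALL `x, y`.  No boundedness, no integrability, every dimension.

This closes the question left open by the cell's R5 files: typer g21/g22 proved it for BOUNDED `φ`
(`exists_measurable_supermodular_version_of_ae`, via the separable tilt, whose cocycle needs bounds) and, without
bounds, in dimension two only (`Plane.exists_measurable_supermodular_version_of_ae_plane`, via double increments,
which are monotone in no orthant order when `|ι| ≥ 3`); `Plane.no_real_supermodular_version_neg_div` shows that the
EXTENSION problem from a box does need bounds — the VERSION problem does not.

Proof (`SahiAEOrthantVersion.lean`, `SahiAEOrthantShift.lean`, this file).  Choose generic base points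
`c₀ > c₁ > ⋯`, `c_k < −k`, consecutive pairs generic (`exists_base_seq`; almost every point and almost every pair
is generic, so the sequence is built by recursion inside a co-null set).  Above each `c_k` the orthant version
`ψ_k = log F_k + S_k` is supermodular on `O_k = {x > c_k}` and `= φ` a.e. there (the monotonicity of `φ − S_k` on
`O_k` is, in the plane, the elementary fact that a grounded 2-increasing function is non-decreasing in each argument,
[cite: Nelsen2006, Lemmas 2.1.3–2.1.4]; in general, increasing differences); consecutive versions differ on `O_k`
by the correction `N_k`, a MODULAR NULL function (`orthantVersion_shift`).  Hence `Ψ_k = ψ_k − Σ_{j<k} N_j` agree on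
overlaps (`glue_consistent`), each is supermodular on `O_k` (modular terms do not matter) and `= φ` a.e.; the glued
function `Ψ(x) = Ψ_{K(x)}(x)`, `K(x) = ⌈‖x‖⌉₊` (so `x ∈ O_{K(x)}`), is Borel, equals `φ` almost everywhere, and any
pair `x, y` together with `x ∧ y`, `x ∨ y` lies in a common `O_k` on which `Ψ = Ψ_k`.
Multiplicative form and product reference measures: `SahiAEOrthantCorollaries.lean`.  No sorries, no new axioms.
-/

noncomputable section

namespace Summit.CriticalPhenomena.PercolationContinuityZ3.Theorems.SahiAEFourFunctions

open MeasureTheory Set Filter Topology Function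
open scoped ENNReal NNReal

variable {ι : Type*} [Fintype ι]

section Glue

variable [DecidableEq ι]

/-! ### A generic decreasing sequence of base points -/

omit [DecidableEq ι] in
/-- A co-null property holds at some point strictly below any prescribed corner. [folklore] -/
theorem exists_of_ae_below {Q : (ι → ℝ) → Prop} (hQ : ∀ᵐ c ∂(volume : Measure (ι → ℝ)), Q c) (m : ι → ℝ) :
    ∃ c, Q c ∧ ∀ i, c i < m i := by
  set B : Set (ι → ℝ) := Set.pi univ fun i => Ioc ((m i - 1) - 1) (m i - 1) with hB
  have hB0 : volume B ≠ 0 := by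
    rw [hB, volume_lowerCorner]; simp
  have hBm : ∀ c ∈ B, ∀ i, c i < m i := fun c hc i => by
    have := (Set.mem_univ_pi.1 hc i).2; linarith
  obtain ⟨c, hcB, hcQ⟩ : ∃ c ∈ B, Q c := by
    by_contra hne
    apply hB0
    refine measure_mono_null (fun c hc => ?_) (ae_iff.1 hQ)
    exact fun h => hne ⟨c, hc, h⟩
  exact ⟨c, hcQ, hBm c hcB⟩

/-- **A generic decreasing sequence of base points**: `c_k < −k` coordinatewise, `c_{k+1} < c_k`, every `c_k`
generic (`ae_generic_base`) and every consecutive pair generic (`ae_pair_generic`). [this work] -/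
theorem exists_base_seq {φ : (ι → ℝ) → ℝ}
    (hsm : ∀ᵐ p ∂(volume : Measure (ι → ℝ)).prod volume, φ p.1 + φ p.2 ≤ φ (p.1 ⊓ p.2) + φ (p.1 ⊔ p.2)) :
    ∃ c : ℕ → ι → ℝ, (∀ k i, c k i < -(k : ℝ)) ∧ (∀ k i, c (k + 1) i < c k i) ∧
      (∀ k i, ∀ᵐ q ∂(volume : Measure (ι → ℝ)).prod (volume : Measure ℝ),
        φ (update (c k) i q.2) + φ q.1 ≤ φ (update (c k) i q.2 ⊓ q.1) + φ (update (c k) i q.2 ⊔ q.1)) ∧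
      (∀ k i, ∀ᵐ rt ∂(volume : Measure ℝ).prod (volume : Measure ℝ),
        φ (update (c k) i rt.1) + φ (update (c (k + 1)) i rt.2) ≤
          φ (update (c k) i rt.1 ⊓ update (c (k + 1)) i rt.2) +
            φ (update (c k) i rt.1 ⊔ update (c (k + 1)) i rt.2)) := by
  -- the co-null set of good base points
  set Gen : (ι → ℝ) → Prop := fun c => ∀ i, ∀ᵐ q ∂(volume : Measure (ι → ℝ)).prod (volume : Measure ℝ),
    φ (update c i q.2) + φ q.1 ≤ φ (update c i q.2 ⊓ q.1) + φ (update c i q.2 ⊔ q.1) with hGen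
  set PG : (ι → ℝ) → (ι → ℝ) → Prop := fun c c' => ∀ i, ∀ᵐ rt ∂(volume : Measure ℝ).prod (volume : Measure ℝ),
    φ (update c i rt.1) + φ (update c' i rt.2) ≤
      φ (update c i rt.1 ⊓ update c' i rt.2) + φ (update c i rt.1 ⊔ update c' i rt.2) with hPG
  set P : (ι → ℝ) → Prop := fun c => Gen c ∧ ∀ᵐ c' ∂(volume : Measure (ι → ℝ)), PG c c' with hP
  have hPae : ∀ᵐ c ∂(volume : Measure (ι → ℝ)), P c := (ae_generic_base hsm).and (ae_pair_generic hsm)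
  -- base and step
  obtain ⟨c₀, hc₀P, hc₀lt⟩ : ∃ c, P c ∧ ∀ i, c i < (fun _ => (0 : ℝ)) i := exists_of_ae_below hPae _
  have step : ∀ (k : ℕ) (c : ι → ℝ), P c → ∃ c', (P c' ∧ PG c c') ∧
      ∀ i, c' i < min (c i) (-((k : ℝ) + 1)) := fun k c hc =>
    exists_of_ae_below (hPae.and hc.2) _
  choose! nxt hnxt using step
  -- the sequence
  set c : ℕ → ι → ℝ := fun k => Nat.rec c₀ (fun k ck => nxt k ck) k with hc
  have hc0 : c 0 = c₀ := rfl
  have hcs : ∀ k, c (k + 1) = nxt k (c k) := fun k => rfl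
  have hcP : ∀ k, P (c k) := fun k => by
    induction k with
    | zero => rw [hc0]; exact hc₀P
    | succ k ih => rw [hcs]; exact (hnxt k (c k) ih).1.1
  refine ⟨c, fun k => ?_, fun k i => ?_, fun k => (hcP k).1, fun k => ?_⟩
  · induction k with
    | zero => intro i; rw [hc0]; simpa using hc₀lt i
    | succ k _ =>
      intro i
      rw [hcs]
      have h := (hnxt k (c k) (hcP k)).2 i
      have : ((k + 1 : ℕ) : ℝ) = (k : ℝ) + 1 := by push_cast; ring
      rw [this]
      exact lt_of_lt_of_le h (min_le_right _ _)
  · rw [hcs]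
    exact lt_of_lt_of_le ((hnxt k (c k) (hcP k)).2 i) (min_le_left _ _)
  · rw [hcs]
    exact (hnxt k (c k) (hcP k)).1.2

/-! ### Consistency of the corrected versions -/

omit [Fintype ι] [DecidableEq ι] in
/-- A decreasing sequence of base points is antitone. [folklore] -/
theorem base_seq_antitone {c : ℕ → ι → ℝ} (hdec : ∀ k i, c (k + 1) i < c k i) {k m : ℕ} (hkm : k ≤ m) :
    c m ≤ c k := by
  induction m, hkm using Nat.le_induction with
  | base => exact le_rfl
  | succ m _ ih => exact fun i => ((hdec m i).le).trans (ih i)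

/-- **Consistency**: the corrected versions `Ψ_m = ψ_{c_m} − Σ_{j<m} N_j` agree with `Ψ_k` on `O_{c_k}` for
`k ≤ m`. [this work] -/
theorem glue_consistent {φ : (ι → ℝ) → ℝ} (hφ : Measurable φ) {c : ℕ → ι → ℝ}
    (hdec : ∀ k i, c (k + 1) i < c k i)
    (hgen : ∀ k i, ∀ᵐ q ∂(volume : Measure (ι → ℝ)).prod (volume : Measure ℝ),
      φ (update (c k) i q.2) + φ q.1 ≤ φ (update (c k) i q.2 ⊓ q.1) + φ (update (c k) i q.2 ⊔ q.1))
    (hpair : ∀ k i, ∀ᵐ rt ∂(volume : Measure ℝ).prod (volume : Measure ℝ),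
      φ (update (c k) i rt.1) + φ (update (c (k + 1)) i rt.2) ≤
        φ (update (c k) i rt.1 ⊓ update (c (k + 1)) i rt.2) + φ (update (c k) i rt.1 ⊔ update (c (k + 1)) i rt.2))
    {k m : ℕ} (hkm : k ≤ m) {p : ι → ℝ} (hp : p ∈ Set.pi univ fun i => Ioi (c k i)) :
    orthantVersion φ (c m) p - ∑ j ∈ Finset.range m, baseCorrection φ (c j) (c (j + 1)) p =
      orthantVersion φ (c k) p - ∑ j ∈ Finset.range k, baseCorrection φ (c j) (c (j + 1)) p := by
  induction m, hkm using Nat.le_induction with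
  | base => rfl
  | succ m hkm ih =>
    have hpm : p ∈ Set.pi univ fun i => Ioi (c m i) := orthant_subset_orthant (base_seq_antitone hdec hkm) hp
    rw [Finset.sum_range_succ, orthantVersion_shift hφ (hdec m) (hgen m) (hpair m) hpm, ← ih]
    ring

/-- **The corrected versions are supermodular on their orthants** (the orthant version is, the corrections are
modular). [this work] -/
theorem glue_supermodular {φ : (ι → ℝ) → ℝ} (hφ : Measurable φ)
    (hsm : ∀ᵐ p ∂(volume : Measure (ι → ℝ)).prod volume, φ p.1 + φ p.2 ≤ φ (p.1 ⊓ p.2) + φ (p.1 ⊔ p.2))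
    {c : ℕ → ι → ℝ} (hdec : ∀ k i, c (k + 1) i < c k i)
    (hgen : ∀ k i, ∀ᵐ q ∂(volume : Measure (ι → ℝ)).prod (volume : Measure ℝ),
      φ (update (c k) i q.2) + φ q.1 ≤ φ (update (c k) i q.2 ⊓ q.1) + φ (update (c k) i q.2 ⊔ q.1))
    (hpair : ∀ k i, ∀ᵐ rt ∂(volume : Measure ℝ).prod (volume : Measure ℝ),
      φ (update (c k) i rt.1) + φ (update (c (k + 1)) i rt.2) ≤
        φ (update (c k) i rt.1 ⊓ update (c (k + 1)) i rt.2) + φ (update (c k) i rt.1 ⊔ update (c (k + 1)) i rt.2))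
    (k : ℕ) {x y : ι → ℝ} (hx : x ∈ Set.pi univ fun i => Ioi (c k i)) (hy : y ∈ Set.pi univ fun i => Ioi (c k i)) :
    (orthantVersion φ (c k) x - ∑ j ∈ Finset.range k, baseCorrection φ (c j) (c (j + 1)) x) +
        (orthantVersion φ (c k) y - ∑ j ∈ Finset.range k, baseCorrection φ (c j) (c (j + 1)) y) ≤
      (orthantVersion φ (c k) (x ⊓ y) - ∑ j ∈ Finset.range k, baseCorrection φ (c j) (c (j + 1)) (x ⊓ y)) +
        (orthantVersion φ (c k) (x ⊔ y) - ∑ j ∈ Finset.range k, baseCorrection φ (c j) (c (j + 1)) (x ⊔ y)) := by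
  have hψ := (orthantVersion_spec hφ hsm (hgen k)).2 x hx y hy
  have hN : ∑ j ∈ Finset.range k, baseCorrection φ (c j) (c (j + 1)) x +
      ∑ j ∈ Finset.range k, baseCorrection φ (c j) (c (j + 1)) y =
      ∑ j ∈ Finset.range k, baseCorrection φ (c j) (c (j + 1)) (x ⊓ y) +
        ∑ j ∈ Finset.range k, baseCorrection φ (c j) (c (j + 1)) (x ⊔ y) := by
    rw [← Finset.sum_add_distrib, ← Finset.sum_add_distrib]
    refine Finset.sum_congr rfl fun j _ => ?_
    exact baseCorrection_modular hφ (ae_monotone_baseFactor (fun i => (hdec j i).le) (hpair j)) x y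
  linarith

/-- **The corrected versions equal `φ` almost everywhere on their orthants.** [this work] -/
theorem glue_ae_eq {φ : (ι → ℝ) → ℝ} (hφ : Measurable φ)
    (hsm : ∀ᵐ p ∂(volume : Measure (ι → ℝ)).prod volume, φ p.1 + φ p.2 ≤ φ (p.1 ⊓ p.2) + φ (p.1 ⊔ p.2))
    {c : ℕ → ι → ℝ} (hdec : ∀ k i, c (k + 1) i < c k i)
    (hgen : ∀ k i, ∀ᵐ q ∂(volume : Measure (ι → ℝ)).prod (volume : Measure ℝ),
      φ (update (c k) i q.2) + φ q.1 ≤ φ (update (c k) i q.2 ⊓ q.1) + φ (update (c k) i q.2 ⊔ q.1))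
    (hpair : ∀ k i, ∀ᵐ rt ∂(volume : Measure ℝ).prod (volume : Measure ℝ),
      φ (update (c k) i rt.1) + φ (update (c (k + 1)) i rt.2) ≤
        φ (update (c k) i rt.1 ⊓ update (c (k + 1)) i rt.2) + φ (update (c k) i rt.1 ⊔ update (c (k + 1)) i rt.2))
    (k : ℕ) :
    ∀ᵐ p ∂(volume : Measure (ι → ℝ)), p ∈ (Set.pi univ fun i => Ioi (c k i)) →
      orthantVersion φ (c k) p - ∑ j ∈ Finset.range k, baseCorrection φ (c j) (c (j + 1)) p = φ p := by
  have hN : ∀ j, ∀ᵐ p ∂(volume : Measure (ι → ℝ)), baseCorrection φ (c j) (c (j + 1)) p = 0 := fun j =>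
    baseCorrection_ae_eq_zero hφ (ae_monotone_baseFactor (fun i => (hdec j i).le) (hpair j))
  filter_upwards [(orthantVersion_spec hφ hsm (hgen k)).1, ae_all_iff.2 hN] with p hp hNp hpO
  rw [hp hpO, Finset.sum_eq_zero fun j _ => hNp j, sub_zero]

end Glue

/-! ### The theorem -/

/-- **The structure theorem in every dimension.**  A measurable function `φ : ℝ^ι → ℝ` (`ι` finite) which is
supermodular on Lebesgue-almost every pair has a Borel version which is supermodular at EVERY pair — no boundedness,
no integrability. [this work] -/
theorem exists_measurable_supermodular_version_of_ae_unbounded (φ : (ι → ℝ) → ℝ) (hφ : Measurable φ)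
    (hsm : ∀ᵐ p ∂(volume : Measure (ι → ℝ)).prod volume, φ p.1 + φ p.2 ≤ φ (p.1 ⊓ p.2) + φ (p.1 ⊔ p.2)) :
    ∃ ψ : (ι → ℝ) → ℝ, Measurable ψ ∧ ψ =ᵐ[volume] φ ∧ ∀ x y, ψ x + ψ y ≤ ψ (x ⊓ y) + ψ (x ⊔ y) := by
  classical
  obtain ⟨c, hlt, hdec, hgen, hpair⟩ := exists_base_seq hsm
  -- the corrected versions (kept opaque) and the index
  obtain ⟨Ψs, hΨs⟩ : ∃ Ψs : ℕ → (ι → ℝ) → ℝ, ∀ k p,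
      Ψs k p = orthantVersion φ (c k) p - ∑ j ∈ Finset.range k, baseCorrection φ (c j) (c (j + 1)) p :=
    ⟨_, fun _ _ => rfl⟩
  obtain ⟨K, hK⟩ : ∃ K : (ι → ℝ) → ℕ, ∀ p, K p = ⌈‖p‖⌉₊ := ⟨_, fun _ => rfl⟩
  have hKm : Measurable K := by
    have e : K = fun p => ⌈‖p‖⌉₊ := funext hK
    rw [e]
    exact Nat.measurable_ceil.comp measurable_norm
  have hmem : ∀ p : ι → ℝ, ∀ k, K p ≤ k → p ∈ Set.pi univ fun i => Ioi (c k i) := by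
    intro p k hk
    refine mem_orthant_iff.2 fun i => ?_
    have h1 : c k i < -(k : ℝ) := hlt k i
    have h2 : ‖p‖ ≤ (K p : ℝ) := by rw [hK]; exact Nat.le_ceil _
    have h3 : (K p : ℝ) ≤ k := by exact_mod_cast hk
    have h4 : |p i| ≤ ‖p‖ := by rw [← Real.norm_eq_abs]; exact norm_le_pi_norm p i
    have h5 : -p i ≤ |p i| := neg_le_abs (p i)
    linarith
  have hΨsm : ∀ k, Measurable (Ψs k) := fun k => by
    have e : Ψs k = fun p =>
        orthantVersion φ (c k) p - ∑ j ∈ Finset.range k, baseCorrection φ (c j) (c (j + 1)) p := funext (hΨs k)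
    rw [e]
    exact (measurable_orthantVersion hφ (c k)).sub
      (Finset.measurable_sum _ fun j _ => measurable_baseCorrection hφ (c j) (c (j + 1)))
  -- consistency, supermodularity and the version property of the corrected versions
  have hcons : ∀ k m, k ≤ m → ∀ p ∈ (Set.pi univ fun i => Ioi (c k i)), Ψs m p = Ψs k p := by
    intro k m hkm p hp
    rw [hΨs, hΨs]
    exact glue_consistent hφ hdec hgen hpair hkm hp
  have hsuper : ∀ k, ∀ x ∈ (Set.pi univ fun i => Ioi (c k i)), ∀ y ∈ (Set.pi univ fun i => Ioi (c k i)),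
      Ψs k x + Ψs k y ≤ Ψs k (x ⊓ y) + Ψs k (x ⊔ y) := by
    intro k x hx y hy
    rw [hΨs, hΨs, hΨs, hΨs]
    exact glue_supermodular hφ hsm hdec hgen hpair k hx hy
  have hae : ∀ k, ∀ᵐ p ∂(volume : Measure (ι → ℝ)), p ∈ (Set.pi univ fun i => Ioi (c k i)) → Ψs k p = φ p := by
    intro k
    filter_upwards [glue_ae_eq hφ hsm hdec hgen hpair k] with p hp hpO
    rw [hΨs]
    exact hp hpO
  refine ⟨fun p => Ψs (K p) p, ?_, ?_, fun x y => ?_⟩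
  · -- measurability
    have h1 : Measurable fun q : (ι → ℝ) × ℕ => Ψs q.2 q.1 :=
      measurable_from_prod_countable_left fun k => hΨsm k
    have e : (fun p => Ψs (K p) p) = (fun q : (ι → ℝ) × ℕ => Ψs q.2 q.1) ∘ fun p => (p, K p) := by
      funext p; rfl
    rw [e]
    exact h1.comp (measurable_id.prodMk hKm)
  · -- version
    filter_upwards [ae_all_iff.2 hae] with p hp
    exact hp (K p) (hmem p (K p) le_rfl)
  · -- supermodularity at every pair: work in a common orthant
    obtain ⟨k, hkx, hky, hkxy, hkxy'⟩ : ∃ k, K x ≤ k ∧ K y ≤ k ∧ K (x ⊓ y) ≤ k ∧ K (x ⊔ y) ≤ k :=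
      ⟨max (max (K x) (K y)) (max (K (x ⊓ y)) (K (x ⊔ y))),
        le_max_of_le_left (le_max_left _ _), le_max_of_le_left (le_max_right _ _),
        le_max_of_le_right (le_max_left _ _), le_max_of_le_right (le_max_right _ _)⟩
    have hx : x ∈ Set.pi univ fun i => Ioi (c k i) := hmem x k hkx
    have hy : y ∈ Set.pi univ fun i => Ioi (c k i) := hmem y k hky
    show Ψs (K x) x + Ψs (K y) y ≤ Ψs (K (x ⊓ y)) (x ⊓ y) + Ψs (K (x ⊔ y)) (x ⊔ y)
    rw [← hcons (K x) k hkx x (hmem x (K x) le_rfl), ← hcons (K y) k hky y (hmem y (K y) le_rfl),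
      ← hcons (K (x ⊓ y)) k hkxy (x ⊓ y) (hmem (x ⊓ y) (K (x ⊓ y)) le_rfl),
      ← hcons (K (x ⊔ y)) k hkxy' (x ⊔ y) (hmem (x ⊔ y) (K (x ⊔ y)) le_rfl)]
    exact hsuper k x hx y hy

/-- **Multiplicative form: a Borel everywhere-MTP₂ version of an a.e.-MTP₂ density, no bounds.**  A measurable
`f : ℝ^ι → (0, ∞)` (finite and non-zero everywhere) which is MTP₂ on Lebesgue-almost every pair,
`f(x) f(y) ≤ f(x ∧ y) f(x ∨ y)`, has a measurable version `F` with `0 < F < ∞` everywhere and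
`F(x) F(y) ≤ F(x ∧ y) F(x ∨ y)` for ALL `x, y`. [this work] -/
theorem exists_measurable_mtp2_version_of_ae_unbounded (f : (ι → ℝ) → ℝ≥0∞) (hf : Measurable f)
    (h0 : ∀ x, f x ≠ 0) (hT : ∀ x, f x ≠ ∞)
    (hMTP : ∀ᵐ p ∂(volume : Measure (ι → ℝ)).prod volume, f p.1 * f p.2 ≤ f (p.1 ⊓ p.2) * f (p.1 ⊔ p.2)) :
    ∃ F : (ι → ℝ) → ℝ≥0∞, Measurable F ∧ (∀ x, F x ≠ 0 ∧ F x ≠ ∞) ∧ F =ᵐ[volume] f ∧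
      ∀ x y, F x * F y ≤ F (x ⊓ y) * F (x ⊔ y) := by
  have hpos : ∀ x, 0 < (f x).toReal := fun x => ENNReal.toReal_pos (h0 x) (hT x)
  set φ : (ι → ℝ) → ℝ := fun x => Real.log (f x).toReal with hφ
  have hφm : Measurable φ := Real.measurable_log.comp (ENNReal.measurable_toReal.comp hf)
  have hsm : ∀ᵐ p ∂(volume : Measure (ι → ℝ)).prod volume, φ p.1 + φ p.2 ≤ φ (p.1 ⊓ p.2) + φ (p.1 ⊔ p.2) := by
    filter_upwards [hMTP] with p hp
    have hL : (f p.1 * f p.2).toReal ≤ (f (p.1 ⊓ p.2) * f (p.1 ⊔ p.2)).toReal :=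
      ENNReal.toReal_mono (ENNReal.mul_ne_top (hT _) (hT _)) hp
    rw [ENNReal.toReal_mul, ENNReal.toReal_mul] at hL
    simp only [hφ]
    rw [← Real.log_mul (hpos _).ne' (hpos _).ne', ← Real.log_mul (hpos _).ne' (hpos _).ne']
    exact Real.log_le_log (mul_pos (hpos _) (hpos _)) hL
  obtain ⟨ψ, hψm, hψφ, hψsm⟩ := exists_measurable_supermodular_version_of_ae_unbounded φ hφm hsm
  refine ⟨fun x => ENNReal.ofReal (Real.exp (ψ x)), ENNReal.measurable_ofReal.comp (Real.measurable_exp.comp hψm),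
    fun x => ⟨(ENNReal.ofReal_pos.2 (Real.exp_pos _)).ne', ENNReal.ofReal_ne_top⟩, ?_, fun x y => ?_⟩
  · filter_upwards [hψφ] with x hx
    rw [hx]
    simp only [hφ]
    rw [Real.exp_log (hpos x), ENNReal.ofReal_toReal (hT x)]
  · rw [← ENNReal.ofReal_mul (Real.exp_pos _).le, ← ENNReal.ofReal_mul (Real.exp_pos _).le, ← Real.exp_add,
      ← Real.exp_add]
    exact ENNReal.ofReal_le_ofReal (Real.exp_le_exp.2 (hψsm x y))

/-- The same with `0 < f < ∞` assumed only almost everywhere; the version is non-zero and finite everywhere.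
[this work] -/
theorem exists_measurable_mtp2_version_of_ae_unbounded' (f : (ι → ℝ) → ℝ≥0∞) (hf : Measurable f)
    (hfin : ∀ᵐ x ∂(volume : Measure (ι → ℝ)), f x ≠ 0 ∧ f x ≠ ∞)
    (hMTP : ∀ᵐ p ∂(volume : Measure (ι → ℝ)).prod volume, f p.1 * f p.2 ≤ f (p.1 ⊓ p.2) * f (p.1 ⊔ p.2)) :
    ∃ F : (ι → ℝ) → ℝ≥0∞, Measurable F ∧ (∀ x, F x ≠ 0 ∧ F x ≠ ∞) ∧ F =ᵐ[volume] f ∧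
      ∀ x y, F x * F y ≤ F (x ⊓ y) * F (x ⊔ y) := by
  set G : Set (ι → ℝ) := {x | f x ≠ 0 ∧ f x ≠ ∞} with hG
  have mG : MeasurableSet G :=
    (hf (measurableSet_singleton 0)).compl.inter (hf (measurableSet_singleton ∞)).compl
  set g : (ι → ℝ) → ℝ≥0∞ := G.piecewise f (fun _ => 1) with hg
  have hgm : Measurable g := hf.piecewise mG measurable_const
  have hg_of_mem : ∀ x ∈ G, g x = f x := fun x hx => Set.piecewise_eq_of_mem _ _ _ hx
  have hg_of_not_mem : ∀ x ∉ G, g x = 1 := fun x hx => Set.piecewise_eq_of_notMem _ _ _ hx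
  have hg0 : ∀ x, g x ≠ 0 := fun x => by
    by_cases hx : x ∈ G
    · rw [hg_of_mem x hx]; exact hx.1
    · rw [hg_of_not_mem x hx]; exact one_ne_zero
  have hgT : ∀ x, g x ≠ ∞ := fun x => by
    by_cases hx : x ∈ G
    · rw [hg_of_mem x hx]; exact hx.2
    · rw [hg_of_not_mem x hx]; exact ENNReal.one_ne_top
  have hgf : g =ᵐ[volume] f := by
    filter_upwards [hfin] with x hx using hg_of_mem x hx
  have hgMTP : ∀ᵐ p ∂(volume : Measure (ι → ℝ)).prod volume, g p.1 * g p.2 ≤ g (p.1 ⊓ p.2) * g (p.1 ⊔ p.2) := by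
    have hGae : ∀ᵐ x ∂(volume : Measure (ι → ℝ)), x ∈ G := by
      filter_upwards [hfin] with x hx using hx
    have hG0 : volume Gᶜ = 0 := ae_iff.1 hGae
    have h1 : ∀ᵐ p : (ι → ℝ) × (ι → ℝ) ∂(volume : Measure (ι → ℝ)).prod volume, p.1 ∈ G :=
      (Measure.quasiMeasurePreserving_fst (μ := (volume : Measure (ι → ℝ)))
        (ν := (volume : Measure (ι → ℝ)))).ae hGae
    have h2 : ∀ᵐ p : (ι → ℝ) × (ι → ℝ) ∂(volume : Measure (ι → ℝ)).prod volume, p.2 ∈ G :=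
      (Measure.quasiMeasurePreserving_snd (μ := (volume : Measure (ι → ℝ)))
        (ν := (volume : Measure (ι → ℝ)))).ae hGae
    have h3 : ∀ᵐ p ∂(volume : Measure (ι → ℝ)).prod volume, p.1 ⊓ p.2 ∈ G := by
      rw [ae_iff]; exact volume_prod_inf_mem_null (N := Gᶜ) hG0
    have h4 : ∀ᵐ p ∂(volume : Measure (ι → ℝ)).prod volume, p.1 ⊔ p.2 ∈ G := by
      rw [ae_iff]; exact volume_prod_sup_mem_null (N := Gᶜ) hG0
    filter_upwards [hMTP, h1, h2, h3, h4] with p hp hp1 hp2 hp3 hp4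
    rw [hg_of_mem _ hp1, hg_of_mem _ hp2, hg_of_mem _ hp3, hg_of_mem _ hp4]
    exact hp
  obtain ⟨F, hFm, hFb, hFg, hFmtp⟩ := exists_measurable_mtp2_version_of_ae_unbounded g hgm hg0 hgT hgMTP
  exact ⟨F, hFm, hFb, hFg.trans hgf, hFmtp⟩

end Summit.CriticalPhenomena.PercolationContinuityZ3.Theorems.SahiAEFourFunctions
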